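import Mathlib.MeasureTheory.Integral.DominatedConvergence
import Mathlib.Analysis.SpecialFunctions.Integrals.Basic
import HarnessLib

/-!
# Stub `stub_annulusLogEnergy` of the line `SketchIdeator2` (card `separatrix-flux-pinning`)
# (crux `MarginalStabilityChain.ChainRealisation`, stmt-AnomalousDissipation-14249)

Sorry-free discharge of the registered stub `stub_annulusLogEnergy` of the lead's skeleton (sibling card
`three-clocks-fat-core-ladder` §1, the single-level log ceiling = barrier note B1).  Pure real analysis over
Mathlib (`intervalIntegral`, `Real.log`).

**Statement (annulus log-energy inequality, polar form).**  If a continuous planar field `(u₁, u₂)` has the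
same circulation `Γ = ∫₀^{2π} r (-sin θ u₁ + cos θ u₂)(r cos θ, r sin θ) dθ` around every circle `|x| = r`,
`δ ≤ r ≤ R` (`0 < δ`), then its kinetic energy in the annulus is at least `Γ²/(2π) · log (R/δ)`:
`Γ²/(2π) log(R/δ) ≤ ∫_δ^R r ∫₀^{2π} (u₁² + u₂²)(r cos θ, r sin θ) dθ dr`.

**Proof.**  Fix `r ∈ [δ, R]`.  Cauchy–Schwarz on `[0, 2π]` (`sq_integral_le`, proved from
`0 ≤ ∫ ((b - a) g - ∫ g)²`) gives `Γ² ≤ 2π ∫₀^{2π} r² (-sin θ u₁ + cos θ u₂)²`, and pointwise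
`(-s a + c b)² ≤ (s² + c²)(a² + b²) = a² + b²` (`trig_sq_le`), so `Γ²/(2π) · r⁻¹ ≤ r · ∫₀^{2π} (u₁² + u₂²)`
(`annulus_abstract`, per-circle step).  Integrate over `r ∈ [δ, R]` with `intervalIntegral.integral_mono_on`:
the left side is `Γ²/(2π) · log (R/δ)` by `integral_inv_of_pos`; interval integrability of the right side comes
from continuity of parametric interval integrals of the jointly continuous integrand
(`intervalIntegral.continuous_parametric_intervalIntegral_of_continuous'`).

References: standard (e.g. the thin-core vortex energy estimate, Saffman, *Vortex Dynamics* (CUP 1992) §3.11;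
Marchioro–Pulvirenti, *Mathematical Theory of Incompressible Nonviscous Fluids* (Springer 1994) Ch. 4).
-/

set_option linter.dupNamespace false

noncomputable section

open MeasureTheory Set Filter Topology

namespace Summit.AnomalousDissipation.AnomalousDissipation.Theorems.ChainRealisation.SeparatrixFluxPinning

/-- Cauchy–Schwarz against the constant `1` on `[a, b]`, squared form: for continuous `g` and `a < b`,
`(∫_a^b g)² ≤ (b - a) ∫_a^b g²`.  Proof: expand `0 ≤ ∫_a^b ((b - a) g - ∫_a^b g)² = (b - a)((b - a) ∫ g² - (∫ g)²)`. -/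
private theorem sq_integral_le {g : ℝ → ℝ} (hg : Continuous g) {a b : ℝ} (hab : a < b) :
    (∫ x in a..b, g x) ^ 2 ≤ (b - a) * ∫ x in a..b, g x ^ 2 := by
  set B := ∫ x in a..b, g x with hB
  set C := ∫ x in a..b, g x ^ 2 with hC
  have h1 : IntervalIntegrable (fun x => (b - a) ^ 2 * g x ^ 2) volume a b :=
    ((hg.pow 2).const_mul _).intervalIntegrable a b
  have h2 : IntervalIntegrable (fun x => 2 * ((b - a) * B) * g x) volume a b :=
    (hg.const_mul _).intervalIntegrable a b
  have h3 : IntervalIntegrable (fun _ : ℝ => B ^ 2) volume a b := intervalIntegrable_const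
  have hexp : ∫ x in a..b, ((b - a) * g x - B) ^ 2 = (b - a) * ((b - a) * C - B ^ 2) := by
    calc ∫ x in a..b, ((b - a) * g x - B) ^ 2
        = ∫ x in a..b, ((b - a) ^ 2 * g x ^ 2 - 2 * ((b - a) * B) * g x + B ^ 2) :=
          intervalIntegral.integral_congr fun x _ => by ring
      _ = (∫ x in a..b, (b - a) ^ 2 * g x ^ 2) - (∫ x in a..b, 2 * ((b - a) * B) * g x)
            + ∫ _ in a..b, B ^ 2 := by
          rw [intervalIntegral.integral_add (h1.sub h2) h3, intervalIntegral.integral_sub h1 h2]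
      _ = (b - a) * ((b - a) * C - B ^ 2) := by
          rw [intervalIntegral.integral_const_mul, intervalIntegral.integral_const_mul,
            intervalIntegral.integral_const, smul_eq_mul]
          ring
  have hnn : 0 ≤ ∫ x in a..b, ((b - a) * g x - B) ^ 2 :=
    intervalIntegral.integral_nonneg hab.le fun _ _ => sq_nonneg _
  rw [hexp, mul_nonneg_iff_of_pos_left (sub_pos.mpr hab)] at hnn
  linarith

/-- Pointwise step on a circle: `(-sin θ · a + cos θ · b)² ≤ a² + b²`, from
`(-s a + c b)² + (s b + c a)² = (s² + c²)(a² + b²)` and `sin² θ + cos² θ = 1`. -/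
private theorem trig_sq_le (θ a b : ℝ) :
    (-Real.sin θ * a + Real.cos θ * b) ^ 2 ≤ a ^ 2 + b ^ 2 := by
  have h : (-Real.sin θ * a + Real.cos θ * b) ^ 2 + (Real.sin θ * b + Real.cos θ * a) ^ 2
      = (Real.sin θ ^ 2 + Real.cos θ ^ 2) * (a ^ 2 + b ^ 2) := by ring
  rw [Real.sin_sq_add_cos_sq, one_mul] at h
  nlinarith [sq_nonneg (Real.sin θ * b + Real.cos θ * a)]

/-- The annulus inequality for an abstract jointly continuous pair: if `G(r, ·)` integrates to `Γ` over
`[0, 2π]` for every `r ∈ [δ, R]` (`0 < δ ≤ R`) and `G² ≤ r² F` pointwise, then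
`Γ²/(2π) log(R/δ) ≤ ∫_δ^R r ∫₀^{2π} F(r, θ) dθ dr` (Cauchy–Schwarz on each circle, then `∫_δ^R dr/r = log (R/δ)`
and monotonicity of the interval integral; the right integrand is continuous in `r`). -/
private theorem annulus_abstract {F G : ℝ → ℝ → ℝ} (hF : Continuous (Function.uncurry F))
    (hG : Continuous (Function.uncurry G)) {δ R Γ : ℝ} (hδ : 0 < δ) (hδR : δ ≤ R)
    (hpt : ∀ r θ, G r θ ^ 2 ≤ r ^ 2 * F r θ)
    (hcirc : ∀ r ∈ Icc δ R, ∫ θ in (0 : ℝ)..(2 * Real.pi), G r θ = Γ) :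
    Γ ^ 2 / (2 * Real.pi) * Real.log (R / δ) ≤
      ∫ r in δ..R, r * ∫ θ in (0 : ℝ)..(2 * Real.pi), F r θ := by
  -- per-circle bound
  have hcircle : ∀ r ∈ Icc δ R,
      Γ ^ 2 / (2 * Real.pi) * r⁻¹ ≤ r * ∫ θ in (0 : ℝ)..(2 * Real.pi), F r θ := by
    intro r hr
    have hr0 : 0 < r := hδ.trans_le hr.1
    have hGr : Continuous (G r) := hG.uncurry_left r
    have hFr : Continuous (F r) := hF.uncurry_left r
    have hcs := sq_integral_le hGr Real.two_pi_pos
    rw [hcirc r hr, sub_zero] at hcs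
    have hmono : ∫ θ in (0 : ℝ)..(2 * Real.pi), G r θ ^ 2 ≤
        ∫ θ in (0 : ℝ)..(2 * Real.pi), r ^ 2 * F r θ :=
      intervalIntegral.integral_mono_on Real.two_pi_pos.le ((hGr.pow 2).intervalIntegrable _ _)
        ((hFr.const_mul _).intervalIntegrable _ _) fun θ _ => hpt r θ
    rw [intervalIntegral.integral_const_mul] at hmono
    have key : Γ ^ 2 ≤ 2 * Real.pi * (r ^ 2 * ∫ θ in (0 : ℝ)..(2 * Real.pi), F r θ) :=
      hcs.trans (mul_le_mul_of_nonneg_left hmono Real.two_pi_pos.le)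
    rw [div_mul_eq_mul_div, div_le_iff₀ Real.two_pi_pos, ← div_eq_mul_inv, div_le_iff₀ hr0]
    have hring : r * (∫ θ in (0 : ℝ)..(2 * Real.pi), F r θ) * (2 * Real.pi) * r =
        2 * Real.pi * (r ^ 2 * ∫ θ in (0 : ℝ)..(2 * Real.pi), F r θ) := by ring
    linarith
  -- continuity of the parametric circle integral
  have hIcont : Continuous fun r => ∫ θ in (0 : ℝ)..(2 * Real.pi), F r θ :=
    intervalIntegral.continuous_parametric_intervalIntegral_of_continuous' hF 0 (2 * Real.pi)
  have hlhs : ∫ r in δ..R, Γ ^ 2 / (2 * Real.pi) * r⁻¹ = Γ ^ 2 / (2 * Real.pi) * Real.log (R / δ) := by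
    rw [intervalIntegral.integral_const_mul, integral_inv_of_pos hδ (hδ.trans_le hδR)]
  rw [← hlhs]
  refine intervalIntegral.integral_mono_on hδR ?_ ((continuous_id.mul hIcont).intervalIntegrable δ R)
    hcircle
  refine (intervalIntegral.intervalIntegrable_inv (f := fun x : ℝ => x) (fun x hx => ?_)
    continuousOn_id).const_mul _
  rw [uIcc_of_le hδR] at hx
  exact (hδ.trans_le hx.1).ne'

/-- Stub (M, Mathlib-only) **Annulus log-energy inequality** (polar form; sibling card
`three-clocks-fat-core-ladder` §1 = barrier note B1, the single-level log ceiling; the line's negative benchmark).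
If a continuous planar field `(u₁,u₂)` has circulation `Γ` around every circle `|x| = r`, `δ ≤ r ≤ R`, then
`Γ²/(2π)·log(R/δ) ≤ ∫_δ^R r ∫₀^{2π} |u(r,θ)|² dθ dr` (Cauchy–Schwarz on each circle: `Γ² ≤ 2π r² ∫₀^{2π} |u|² dθ`,
then `∫_δ^R dr/r = log(R/δ)`; continuity of the parametric circle integrals gives interval integrability). -/
theorem stub_annulusLogEnergy :
    ∀ (u₁ u₂ : ℝ → ℝ → ℝ) (δ R Γ : ℝ),
      Continuous (fun q : ℝ × ℝ => (u₁ q.1 q.2, u₂ q.1 q.2)) → 0 < δ → δ ≤ R →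
      (∀ r ∈ Icc δ R,
        ∫ θ in (0 : ℝ)..(2 * Real.pi),
          r * (-Real.sin θ * u₁ (r * Real.cos θ) (r * Real.sin θ) +
                Real.cos θ * u₂ (r * Real.cos θ) (r * Real.sin θ)) = Γ) →
      Γ ^ 2 / (2 * Real.pi) * Real.log (R / δ) ≤
        ∫ r in δ..R, r * ∫ θ in (0 : ℝ)..(2 * Real.pi),
          (u₁ (r * Real.cos θ) (r * Real.sin θ) ^ 2 + u₂ (r * Real.cos θ) (r * Real.sin θ) ^ 2) := by
  intro u₁ u₂ δ R Γ hu hδ hδR hcirc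
  have hu₁ : Continuous fun q : ℝ × ℝ => u₁ q.1 q.2 := hu.fst
  have hu₂ : Continuous fun q : ℝ × ℝ => u₂ q.1 q.2 := hu.snd
  have hpol : Continuous fun p : ℝ × ℝ => (p.1 * Real.cos p.2, p.1 * Real.sin p.2) := by fun_prop
  have hU₁ : Continuous fun p : ℝ × ℝ => u₁ (p.1 * Real.cos p.2) (p.1 * Real.sin p.2) := hu₁.comp hpol
  have hU₂ : Continuous fun p : ℝ × ℝ => u₂ (p.1 * Real.cos p.2) (p.1 * Real.sin p.2) := hu₂.comp hpol
  have hF : Continuous (Function.uncurry fun r θ : ℝ =>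
      u₁ (r * Real.cos θ) (r * Real.sin θ) ^ 2 + u₂ (r * Real.cos θ) (r * Real.sin θ) ^ 2) :=
    (hU₁.pow 2).add (hU₂.pow 2)
  have hG : Continuous (Function.uncurry fun r θ : ℝ =>
      r * (-Real.sin θ * u₁ (r * Real.cos θ) (r * Real.sin θ) +
        Real.cos θ * u₂ (r * Real.cos θ) (r * Real.sin θ))) :=
    continuous_fst.mul ((((Real.continuous_sin.comp continuous_snd).neg).mul hU₁).add
      ((Real.continuous_cos.comp continuous_snd).mul hU₂))
  refine annulus_abstract
    (F := fun r θ : ℝ => u₁ (r * Real.cos θ) (r * Real.sin θ) ^ 2 + u₂ (r * Real.cos θ) (r * Real.sin θ) ^ 2)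
    (G := fun r θ : ℝ => r * (-Real.sin θ * u₁ (r * Real.cos θ) (r * Real.sin θ) +
      Real.cos θ * u₂ (r * Real.cos θ) (r * Real.sin θ)))
    hF hG hδ hδR (fun r θ => ?_) hcirc
  rw [mul_pow]
  exact mul_le_mul_of_nonneg_left (trig_sq_le θ _ _) (sq_nonneg r)

end Summit.AnomalousDissipation.AnomalousDissipation.Theorems.ChainRealisation.SeparatrixFluxPinning

end
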